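import Mathlib
import Literature.MathematicalPhysics.QuantumFieldTheory.Balaban1983to89.B9Thm314

/-!
# `Balaban1983to89.B9Locality` — [Balaban1985BackgroundPropagators] Sect. C (pp. 408–416): the LOCALITY CLAUSE of the
generalized random walk expansions (3.90), (3.98), (3.107) at CONSTRUCTION LEVEL — both halves (gauge field U AND the
sequence of domains {Ω_j}) — and its two printed uses (the cancellation sentence of the proof of Theorem 3.14, p. 427;
the "coincide" remark of [Balaban1988Convergent] p. 278) as KERNEL-CHECKED consequences of NAMED locality laws

CITATION HEADER (lean-in-tree rule 2026-08-18).  Source: T. Bałaban, *Propagators for lattice gauge theories in a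
background field*, Commun. Math. Phys. **99**, 389–434 (1985) [Balaban1985BackgroundPropagators] (cell paper B9; held
`paper:balaban1985-cmp99-background-propagators`, journal page = PDF page + 388; every quotation below was read from the
page renders pp. 408, 409, 410, 413, 415, 416, 426, 427); its [4] = *Propagators and renormalization transformations
for lattice gauge theories. II*, Commun. Math. Phys. **96**, 223–250 (1984) [Balaban1984PropagatorsII] (B6), p. 229
(2.36); its [3] = part I, Commun. Math. Phys. **95**, 17–40 (1984) [Balaban1984PropagatorsI] (B5), p. 36 (1.118).  The
consumer whose sentence is at stake: *Convergent renormalization expansions for lattice gauge theories*, Commun. Math.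
Phys. **119**, 243–285 (1988) [Balaban1988Convergent] (B14), p. 276 and p. 278.  SIBLING of `…Balaban1983to89.B9` and
`…Balaban1983to89.B9Thm314` (imports the latter, restates none of their declarations): `B9.RWExpansion.LocDep` and
`B9.Cor38Printed` carry the printed clause as an OPAQUE `Prop`; `B9Thm314.DiffExpansionPrinted` carries the cancellation
as a LEAF; this module gives both a checkable meaning one level down, over abstract operator values.

THE PRINTED TEXT (verbatim).  p. 408: *"We take a family 𝒟_j of cubes □, with centers at points of this lattice, which
are unions of 2^d big blocks, with at least one of them contained in B^j(Λ_j). A union of these families for all j is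
denoted by 𝒟. … We take the partition of unity {h_□} defined at the end of Sect. A in [4]. We have Σ_{□∈𝒟} h_□² = 1.
For a cube □ ∈ 𝒟 and n = 1, 2, … we define □̃ⁿ as a cube of the size (2 + 2n)ML^jη, and with the same center as □"*;
*"Let us take a cube □ ∈ 𝒟_j, and let us define a sequence {Ω_n(□)}_{n=0,…,j+1} of domains in the following way. The
cube □̃³ is either contained in B^j(Λ_j), or intersects also the domain B^{j+1}(Λ_{j+1}). Let us assume the second case,
then we defined Ω_{j+1}(□) = □̃³ ∩ B^{j+1}(Λ_{j+1}). We take Ω_j(□) = □̃⁴, … generally Ω_n(□) is a cube with a center at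
the center of □ and dist(Ω_n(□)ᶜ, Ω_{n+1}(□)) = 2R₀M₀Lⁿη … hence Ω₀(□) ⊂ □̃⁵."*  p. 409: *"The operators constructed for
this sequence, which we denote by G′_□(U), C_□(U) = (Q′(U)G′²_□(U)Q′*(U))⁻¹, G_□(U), satisfy all the inequalities of
Theorems 3.1–3.3"*; (3.87) *"G′₀ = Σ_{□∈𝒟} h_□G′_□h_□"*; (3.88) *"Using (3.50) we get for x ∈ Δ(y), y ∈ Λ_j, (Δ′_a hλ)(x)
= h(x)(Δ′_aλ)(x) − Σ_{b∈st(x)}(∂h)(b)(Dλ)(b) + (Δh)(x)λ(x) + a_j(L^jη)⁻² Σ_{x′∈B^j(y)} L^{−jd}(∂h)(Γ^{(j)}_{x,y} ∪ Γ^{(j)}_{y,x′})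
R((U(Γ^{(j)}_{y,x}))⁻¹R(U(Γ^{(j)}_{y,x′}))λ(x′) = h(x)(Δ′_aλ)(x) − (K(h)λ)(x)"*, *"Δ′_aG′₀ = I − Σ_□ K(h_□)G′_□h_□ = I − R′"*;
Theorem 3.7 (3.90) *"G′ = Σ_ω h_{□₀}G′_{□₀}h_{□₀}K(h_{□₁})G′_{□₁}h_{□₁}·⋯·K(h_{□ₙ})G′_{□ₙ}h_{□ₙ}, where ω = (□₀, □₁, ⋯, □ₙ),
□ᵢ ∈ 𝒟, □ᵢ ∩ □ᵢ₊₁ ≠ ∅"*.  p. 410: *"The main purpose of the expansion (3.90) is to express G′ in terms of localized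
operators … We are interested in localization for the gauge field U. A propagator G′_□ depends on U restricted to
Ω₀(□) ⊂ □̃⁵, and the operator K(h) is semi-local, hence a term in (3.90) corresponding to a walk ω = (□₀, □₁, …, □ₙ)
depends on U restricted to □̃⁵₀ ∪ □̃⁵₁ ∪ … ∪ □̃⁵ₙ"* (= Corollary 3.8, first clause).  p. 413: R′_α(X) *"is localized in
X, i.e. its kernel has a support in X × X, it depends on U restricted to X̃⁵"*; p. 416 (Theorem 3.10): *"the sum is over
walks ω = ((0, X₀), (α₁, X₁), …, (αₙ, Xₙ)) satisfying X_{i−1} ∩ X_i ≠ ∅ … A term in this expansion, corresponding to a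
walk ω, depends on configuration U restricted to X̃⁵₀ ∪ X̃⁵₁ ∪ … ∪ X̃⁵ₙ"*.  p. 426–427 (Theorem 3.14 and its proof): *"We
construct operators for both sequences and we define Ω = Ω_k ∩ Ω′_k … We take random walk expansions for both operators,
and in the difference all terms for walks with localizations contained in Ω are cancelled. Remaining terms correspond to
walks of the general type (3.107), for which at least one localization X_i intersects Ωᶜ."*  [Balaban1988Convergent]
p. 276: *"we apply Theorems 3.7–3.10 [13] in their full generality"*; p. 278: *"The important remark is that the terms
𝐄₀^{(k+1)}(Λ_{k+1}, X, z) of this representation, for X ⊂ Λ_{k+1}, do not depend on Λ_{k+1}, and coincide with the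
corresponding terms arising from the expressions defined on the whole lattice, i.e. in the framework of [I]."*
[4] p. 229 (end of Sect. A): *"We cover B^j(Λ_j) by a sum of cubes □ of the size 2ML^jη, each cube being a sum of 2^d
big blocks with a center y ∈ Λ_j … Taking these covers for all j from 0 to k we get a family 𝒟 of cubes □ of different
sizes and such that T_η = ∪_{□∈𝒟} □. … We construct also the corresponding family of functions h described in (1.118), and
rescale them to proper scales. They satisfy Σ_{□∈𝒟} h_□² = 1. (2.36)"* ([3] (1.118): single-scale bumps with Σ_z h_z² = 1).

WHAT IS REPRODUCED (surge node T-G17, unit `b2b-balaban-pv05`; cell TEMPLATE v4 §14.2b row 13, GAPS G-B14s-17).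
§1  What "depends on (U, {Ω_j}) restricted to X" MEANS: the problem data are ONE function `p : Site → β` (at a point:
    the bond variables issuing from it AND its scale label, i.e. the {Ω_j} through x ↦ #{j : x ∈ Ω_j}); a quantity
    `f p` depends on p restricted to X iff it is constant on data agreeing on X (`DependsOnlyOn`), iff it factors
    through the restriction map (`dependsOnlyOn_iff_factorsThrough`).  Unit factors LOCAL in a localisation
    neighbourhood `N c` (`IsLocalIn`; the printed N(□) = □̃⁵, N((α, X)) = X̃⁵) are closed under products, sums,
    differences and post-composition (the units of (3.98)/(3.107) are built from those of (3.90) by exactly these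
    operations, pp. 411–415) and under enlarging N (`IsLocalIn.mono`).
§2  The printed inference of p. 410 as a theorem: a walk term F₀(p, c₀)·F(p, c₁)⋯F(p, cₙ) whose factors are local
    depends on p restricted to N(ω) = N(c₀) ∪ … ∪ N(cₙ) (`Walk.term_congr`) — for the data function p this is the
    U-half (Cor. 3.8, Thm. 3.10, printed) AND the {Ω_j}-half (used at p. 427 and at [Balaban1988Convergent] p. 278,
    printed nowhere as a statement) in ONE statement.  The (3.90)-TYPE EXPANSION with data-dependent admissibility
    (`RWModel`: □ ∈ 𝒟(p) is itself region data, law `mem_local`; consecutive intersection `Geo` is geometry) and its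
    laws `RWModel.Laws` = the four places where region data enter, R1–R4 of the docstring of `RWModel.Laws`, each with
    its page; the indicator-weighted term `iterm` over ALL candidate walks, so that two problems are compared on ONE
    index set.
§3  KERNEL-CHECKED consequences of the laws: `iterm_congr` / `iterm_dependsOnlyOn` (Cor. 3.8 both halves);
    `iterm_eq_of_confined` (two problems agreeing on a set S have IDENTICAL terms for every walk confined to S — the
    "coincide" of [Balaban1988Convergent] p. 278 and "for walks with localizations contained in Ω", p. 427);
    `sum_sub_sum_eq_sum_touching` (finite truncations: the difference of the two expansions IS the sum over walks
    touching Sᶜ of the term differences — walks admissible for one problem only are touching, with one term zero);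
    `tsum_sub_tsum_eq_tsum_touching` (the same for the convergent series); `norm_tsum_sub_tsum_le` (hence the norm of
    the difference of the two operators is at most the sum over TOUCHING walks of the two term bounds — the input to
    "the exponential factor in (3.108) gives the factor (3.154)", whose metric step is `B9Thm314.dOmega_le_wdist_add`);
    the index form of "at least one localization X_i intersects Ωᶜ" (`Walk.touches_iff_exists_index`, the shape of
    `B9Thm314.LocData.Touches`); and the Thm 3.14 setting "same U, two sequences" (`eqOn_pair_iff`).
WHAT IS *NOT* REPRODUCED OR ASSERTED: that Bałaban's operators h_□G′_□h_□, K(h_□)G′_□h_□, R′_α(X), R_α(X) satisfy the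
laws — the laws are HYPOTHESES (fields of `RWModel.Laws`), justified factor by factor in their docstrings from the
printed construction and never discharged here (no lattice, no operators are constructed); any bound ((3.89), (3.94),
(3.99), (3.108)) or convergence (Thm 3.7) — summability is a hypothesis where used; the multiscale normalisation of
{h_□} at scale interfaces ([4] (2.36) refers to the single-scale (1.118) only), on which the exact localisation radius
of law R4 depends near interfaces (cell GAPS row C-pv05-2: for walks of top-scale cubes N(□) = □̃⁵ suffices as
printed).  DICTIONARY: `Site → β` ∋ p = (U, {Ω_j}) as local data; `C` = candidate units of all scales (cubes □ of the
block lattices, or pairs (α, X)); `RWModel.N c` = □̃⁵ / X̃⁵; `RWModel.Mem p c` = □ ∈ 𝒟 for the sequence encoded by p;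
`RWModel.Geo ω` = □ᵢ ∩ □ᵢ₊₁ ≠ ∅ for all i (and, for (3.107), α₀ = 0); `RWModel.F₀ p □` = h_□G′_□(U)h_□ (resp. R₀(X₀)),
`RWModel.F p □` = K(h_□)G′_□(U)h_□ (resp. R_α(X)); `A` = the operator ring; `S` = Ω = Ω_k ∩ Ω′_k (p. 426) or Λ_{k+1}
([Balaban1988Convergent] p. 278); `Walk.Touches N S ω` = "at least one localization X_i intersects Sᶜ".  NOTHING of
the series is asserted; value = typed skeleton + located gap, NOT summit progress.  Companion rows: cell `GAPS.md`
C-pv05-2, `DIVERGENCE.md` D-pv05.2.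
-/

namespace Literature.MathematicalPhysics.QuantumFieldTheory.Balaban1983to89.B9Locality

/-! ## §1 Local data, dependence on restricted data, local unit factors -/

section DependsOnlyOn

variable {Site β A : Type*}

/-- *"depends on U restricted to X"* (p. 410, p. 413, p. 416) for a quantity `f p` of the problem data
`p : Site → β` (gauge field AND scale labels as one local data function): data agreeing on `X` give the same value.
[cite: Balaban1985BackgroundPropagators, Cor 3.8 p.410 + Thm 3.10 p.416] -/
def DependsOnlyOn (X : Set Site) (f : (Site → β) → A) : Prop :=
  ∀ ⦃p p' : Site → β⦄, Set.EqOn p p' X → f p = f p'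

/-- The literal reading of "restricted to X": `f` factors through the restriction map `p ↦ p|X`.  [folklore] -/
theorem dependsOnlyOn_iff_factorsThrough [Nonempty A] (X : Set Site) (f : (Site → β) → A) :
    DependsOnlyOn X f ↔ ∃ Φ : (X → β) → A, ∀ p : Site → β, f p = Φ (X.restrict p) := by
  classical
  refine ⟨fun h => ⟨fun q => if hq : ∃ p₁ : Site → β, X.restrict p₁ = q then f hq.choose
    else Classical.arbitrary A, fun p => ?_⟩, ?_⟩
  · have hq : ∃ p₁ : Site → β, X.restrict p₁ = X.restrict p := ⟨p, rfl⟩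
    dsimp only
    rw [dif_pos hq]
    refine h fun x hx => ?_
    have := congrFun hq.choose_spec ⟨x, hx⟩
    simpa only [Set.restrict_apply] using this.symm
  · rintro ⟨Φ, hΦ⟩ p p' hpp'
    rw [hΦ p, hΦ p']
    congr 1
    funext x
    exact hpp' x.2

/-- Dependence on restricted data is monotone in the set. [folklore] -/
theorem DependsOnlyOn.mono {X X' : Set Site} {f : (Site → β) → A} (h : DependsOnlyOn X f) (hXX' : X ⊆ X') :
    DependsOnlyOn X' f :=
  fun _ _ hpp' => h (hpp'.mono hXX')

end DependsOnlyOn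

section Local

variable {Site β C A A' : Type*}

/-- LOCALITY of a family of unit factors `F p c` (unit `c` = a cube □ or a pair (α, X); `N c` = its localisation
neighbourhood, printed □̃⁵ resp. X̃⁵): the factor of unit `c` depends on the data restricted to `N c` — p. 410 *"A
propagator G′_□ depends on U restricted to Ω₀(□) ⊂ □̃⁵, and the operator K(h) is semi-local"*, p. 413 *"it depends on U
restricted to X̃⁵"*. [cite: Balaban1985BackgroundPropagators, Sect. C p.410 + p.413] -/
def IsLocalIn (N : C → Set Site) (F : (Site → β) → C → A) : Prop :=
  ∀ ⦃p p' : Site → β⦄ (c : C), Set.EqOn p p' (N c) → F p c = F p' c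

/-- The same for a data-dependent PREDICATE on units (membership □ ∈ 𝒟, p. 408). [cite: Balaban1985BackgroundPropagators, Sect. C p.408] -/
def IsLocalPredIn (N : C → Set Site) (P : (Site → β) → C → Prop) : Prop :=
  ∀ ⦃p p' : Site → β⦄ (c : C), Set.EqOn p p' (N c) → (P p c ↔ P p' c)

/-- `IsLocalIn` is `DependsOnlyOn (N c)` unit by unit. [folklore] -/
theorem isLocalIn_iff_dependsOnlyOn (N : C → Set Site) (F : (Site → β) → C → A) :
    IsLocalIn N F ↔ ∀ c, DependsOnlyOn (N c) (fun p => F p c) :=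
  ⟨fun h c _ _ hpp' => h c hpp', fun h _ _ c hpp' => h c hpp'⟩

/-- Enlarging the localisation neighbourhoods preserves locality (used when N(□) must be taken larger than □̃⁵, e.g.
near scale interfaces for h_□). [folklore] -/
theorem IsLocalIn.mono {N N' : C → Set Site} {F : (Site → β) → C → A} (h : IsLocalIn N F)
    (hNN' : ∀ c, N c ⊆ N' c) : IsLocalIn N' F :=
  fun _ _ c hpp' => h c (hpp'.mono (hNN' c))

/-- Data-independent factors (ζ_□̃, characteristic functions, p. 414) are local. [folklore] -/
theorem isLocalIn_const (N : C → Set Site) (f : C → A) : IsLocalIn N (fun (_ : Site → β) c => f c) :=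
  fun _ _ _ _ => rfl

/-- A binary operation of two local families is local (products K(h′_□)G′_□h′_□, sums, differences
G′²_{□₀} − G′²_□ and commutators [·, h′²] of local pieces, pp. 411–415). [folklore] -/
theorem IsLocalIn.op₂ {N : C → Set Site} {F : (Site → β) → C → A} {G : (Site → β) → C → A'} {A'' : Type*}
    (op : A → A' → A'') (hF : IsLocalIn N F) (hG : IsLocalIn N G) :
    IsLocalIn N (fun p c => op (F p c) (G p c)) :=
  fun _ _ c hpp' => by
    dsimp only
    rw [hF c hpp', hG c hpp']

/-- Post-composition with a data-independent map is local. [folklore] -/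
theorem IsLocalIn.postcomp {N : C → Set Site} {F : (Site → β) → C → A} (φ : C → A → A') (hF : IsLocalIn N F) :
    IsLocalIn N (fun p c => φ c (F p c)) :=
  fun _ _ c hpp' => by
    dsimp only
    rw [hF c hpp']

/-- Products of local families are local. [folklore] -/
theorem IsLocalIn.mul [Mul A] {N : C → Set Site} {F G : (Site → β) → C → A} (hF : IsLocalIn N F)
    (hG : IsLocalIn N G) : IsLocalIn N (fun p c => F p c * G p c) :=
  hF.op₂ (· * ·) hG

/-- Differences of local families are local. [folklore] -/
theorem IsLocalIn.sub [Sub A] {N : C → Set Site} {F G : (Site → β) → C → A} (hF : IsLocalIn N F)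
    (hG : IsLocalIn N G) : IsLocalIn N (fun p c => F p c - G p c) :=
  hF.op₂ (· - ·) hG

end Local

/-! ## §2 Walks, localisation N(ω), walk terms; the (3.90)-type expansion with data-dependent admissibility -/

/-- A WALK ω = (c₀, [c₁, …, cₙ]) of units (*"ω = (□₀, □₁, ⋯, □ₙ)"*, (3.90); *"ω = ((0, X₀), (α₁, X₁), …, (αₙ, Xₙ))"*,
(3.107)); |ω| = n. [cite: Balaban1985BackgroundPropagators, (3.90) p.409 + (3.107) p.416] -/
abbrev Walk (C : Type*) : Type _ := C × List C

namespace Walk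

variable {Site β C A : Type*}

/-- The list of units (□₀, □₁, …, □ₙ). [cite: Balaban1985BackgroundPropagators, (3.90) p.409] -/
def units (ω : Walk C) : List C := ω.1 :: ω.2

/-- |ω| = n (p. 410: *"Let us denote |ω| = n"*). [cite: Balaban1985BackgroundPropagators, Cor 3.8 p.410] -/
def len (ω : Walk C) : ℕ := ω.2.length

/-- The localisation N(ω) = N(c₀) ∪ … ∪ N(cₙ) (printed: □̃⁵₀ ∪ □̃⁵₁ ∪ … ∪ □̃⁵ₙ, resp. X̃⁵₀ ∪ … ∪ X̃⁵ₙ). [cite: Balaban1985BackgroundPropagators, Cor 3.8 p.410 + Thm 3.10 p.416] -/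
def loc (N : C → Set Site) (ω : Walk C) : Set Site := {x | ∃ c ∈ ω.units, x ∈ N c}

/-- *"walks with localizations contained in Ω"* (p. 427). [cite: Balaban1985BackgroundPropagators, Thm 3.14 proof p.427] -/
def Confined (N : C → Set Site) (S : Set Site) (ω : Walk C) : Prop := ω.loc N ⊆ S

/-- *"at least one localization X_i intersects Ωᶜ"* (p. 427). [cite: Balaban1985BackgroundPropagators, Thm 3.14 proof p.427] -/
def Touches (N : C → Set Site) (S : Set Site) (ω : Walk C) : Prop := ∃ c ∈ ω.units, ¬ (N c ⊆ S)

/-- The ordered product F₀(p, c₀)·F(p, c₁)⋯F(p, cₙ) of a walk — the term of (3.90) (F₀ = h_□G′_□h_□, F = K(h_□)G′_□h_□)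
resp. of (3.107) (F₀ = R₀(X₀), F = R_α(X)). [cite: Balaban1985BackgroundPropagators, (3.90) p.409 + (3.107) p.416] -/
def term [Monoid A] (F₀ F : (Site → β) → C → A) (p : Site → β) (ω : Walk C) : A :=
  F₀ p ω.1 * (ω.2.map (F p)).prod

/-- The first unit is a unit. [folklore] -/
theorem fst_mem_units (ω : Walk C) : ω.1 ∈ ω.units := by simp [units]

/-- Later units are units. [folklore] -/
theorem mem_units_of_mem_snd {ω : Walk C} {c : C} (h : c ∈ ω.2) : c ∈ ω.units := by simp [units, h]

/-- A walk with |ω| = n has n + 1 units. [folklore] -/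
theorem length_units (ω : Walk C) : ω.units.length = ω.len + 1 := by simp [units, len]

/-- N(c) ⊆ N(ω) for every unit c of ω. [folklore] -/
theorem subset_loc (N : C → Set Site) {ω : Walk C} {c : C} (h : c ∈ ω.units) : N c ⊆ ω.loc N :=
  fun _ hx => ⟨c, h, hx⟩

/-- Confinement is unit-wise. [folklore] -/
theorem confined_iff {N : C → Set Site} {S : Set Site} {ω : Walk C} :
    ω.Confined N S ↔ ∀ c ∈ ω.units, N c ⊆ S :=
  ⟨fun h _ hc => (subset_loc N hc).trans h, fun h _ ⟨c, hc, hx⟩ => h c hc hx⟩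

/-- A walk touches Sᶜ iff it is not confined to S. [folklore] -/
theorem touches_iff_not_confined {N : C → Set Site} {S : Set Site} {ω : Walk C} :
    ω.Touches N S ↔ ¬ ω.Confined N S := by
  rw [confined_iff]
  constructor
  · rintro ⟨c, hc, hcS⟩ h
    exact hcS (h c hc)
  · intro h
    by_contra h'
    exact h fun c hc => by_contra fun hcS => h' ⟨c, hc, hcS⟩

/-- The index form *"at least one localization X_i, i ∈ {0, …, |ω|}, intersects Ωᶜ"* (the shape of
`B9Thm314.LocData.Touches`). [cite: Balaban1985BackgroundPropagators, Thm 3.14 proof p.427] -/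
theorem touches_iff_exists_index {N : C → Set Site} {S : Set Site} {ω : Walk C} :
    ω.Touches N S ↔ ∃ (m : ℕ) (hm : m < ω.units.length), ¬ (N (ω.units[m]) ⊆ S) := by
  constructor
  · rintro ⟨c, hc, hcS⟩
    obtain ⟨m, hm, rfl⟩ := List.getElem_of_mem hc
    exact ⟨m, hm, hcS⟩
  · rintro ⟨m, hm, hmS⟩
    exact ⟨_, List.getElem_mem hm, hmS⟩

/-- **The printed inference of p. 410** (*"A propagator G′_□ depends on U restricted to Ω₀(□) ⊂ □̃⁵, and the operator
K(h) is semi-local, hence a term in (3.90) corresponding to a walk ω = (□₀, □₁, …, □ₙ) depends on U restricted to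
□̃⁵₀ ∪ □̃⁵₁ ∪ … ∪ □̃⁵ₙ"*), for the whole data function (U AND {Ω_j}): local factors ⇒ the walk term depends on the data
restricted to N(ω). [cite: Balaban1985BackgroundPropagators, Cor 3.8 p.410] -/
theorem term_congr [Monoid A] {N : C → Set Site} {F₀ F : (Site → β) → C → A} (h₀ : IsLocalIn N F₀)
    (h : IsLocalIn N F) {p p' : Site → β} {ω : Walk C} (hag : Set.EqOn p p' (ω.loc N)) :
    ω.term F₀ F p = ω.term F₀ F p' := by
  unfold term
  have e₀ : F₀ p ω.1 = F₀ p' ω.1 := h₀ ω.1 (hag.mono (subset_loc N ω.fst_mem_units))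
  have e : ω.2.map (F p) = ω.2.map (F p') :=
    List.map_congr_left fun c hc => h c (hag.mono (subset_loc N (mem_units_of_mem_snd hc)))
  rw [e₀, e]

/-- The same as a `DependsOnlyOn` statement. [cite: Balaban1985BackgroundPropagators, Cor 3.8 p.410] -/
theorem term_dependsOnlyOn [Monoid A] {N : C → Set Site} {F₀ F : (Site → β) → C → A} (h₀ : IsLocalIn N F₀)
    (h : IsLocalIn N F) (ω : Walk C) : DependsOnlyOn (ω.loc N) (fun p => ω.term F₀ F p) :=
  fun _ _ hag => term_congr h₀ h hag

end Walk

/-- A RANDOM WALK EXPANSION OF TYPE (3.90)/(3.98)/(3.107) AT CONSTRUCTION LEVEL: candidate units `C` (cubes of the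
block lattices of all scales, resp. pairs (α, X)), localisation neighbourhoods `N` (□̃⁵, resp. X̃⁵), the DATA-DEPENDENT
membership `Mem p c` (*"□ᵢ ∈ 𝒟"* — the family 𝒟 = ∪_j 𝒟_j is determined by the regions {B^j(Λ_j)}, p. 408), the
data-independent geometric admissibility `Geo` (*"□ᵢ ∩ □ᵢ₊₁ ≠ ∅"*, resp. *"X_{i−1} ∩ X_i ≠ ∅"* and α₀ = 0), and the two
unit-factor families of the ordered product (`F₀` first factor, `F` the others) with values in the operator ring `A`.
Data only; the printed locality is `RWModel.Laws`. [cite: Balaban1985BackgroundPropagators, Thm 3.7 (3.90) p.409 + Thm 3.10 (3.107) p.416] -/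
structure RWModel (Site β C A : Type*) where
  N : C → Set Site
  Mem : (Site → β) → C → Prop
  Geo : Walk C → Prop
  F₀ : (Site → β) → C → A
  F : (Site → β) → C → A

namespace RWModel

variable {Site β C A : Type*}

/-- THE LOCALITY LAWS = the four places where the problem data enter a factor of (3.90), each inside N(□) = □̃⁵ by the
printed construction (hypotheses about Bałaban's operators, justified here by quotation, never discharged):
`mem_local` (R1) — □ ∈ 𝒟_j iff *"at least one of [its 2^d big blocks is] contained in B^j(Λ_j)"* (p. 408): region data
inside □; `F₀_local`, `F_local` — (R2) G′_□(U) is the operator of Thms 3.1–3.3 for the LOCAL sequence {Ω_n(□)}, which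
is determined by □, its scale j and B^{j+1}(Λ_{j+1}) ∩ □̃³ (*"Ω_{j+1}(□) = □̃³ ∩ B^{j+1}(Λ_{j+1}) … Ω_j(□) = □̃⁴ …
Ω₀(□) ⊂ □̃⁵"*, p. 408) and depends on U restricted to Ω₀(□) (p. 410); (R3) K(h_□) of (3.88) is assembled from ∂h_□,
Δh_□, the covariant derivative D (U on the bonds at x) and the a_j-averaging term over the block B^j(y) ∋ x, y ∈ Λ_j,
with transporters R(U(Γ^{(j)}_{y,x})) — the scale label and U within one block of supp ∂h_□ ⊂ □̃ (*"semi-local"*,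
p. 410); (R4) h_□ is the member of the partition of unity over 𝒟 ([4] p. 229 (2.36) ← [3] (1.118)), determined by the
cubes of 𝒟 meeting supp h_□ — inside □̃⁵ when these have scale ≤ j (always so for top-scale cubes; the multiscale
normalisation at interfaces is not printed, cf. `IsLocalIn.mono`).  For (3.98)/(3.107) the units R′_α(X), R_α(X) are
products, differences and commutators of the same local objects on the canonical re-partitions 𝒟′, 𝒟″ around the cube
(pp. 411–415; *"it depends on U restricted to X̃⁵"*, p. 413), cf. `IsLocalIn.mul`, `IsLocalIn.sub`. [cite: Balaban1985BackgroundPropagators, Sect. C pp.408–415]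
[cite: Balaban1984PropagatorsII, (2.36) p.229] -/
structure Laws (E : RWModel Site β C A) : Prop where
  mem_local : IsLocalPredIn E.N E.Mem
  F₀_local : IsLocalIn E.N E.F₀
  F_local : IsLocalIn E.N E.F

/-- ADMISSIBILITY of a candidate walk for the data p: *"□ᵢ ∈ 𝒟, □ᵢ ∩ □ᵢ₊₁ ≠ ∅"* (p. 409). [cite: Balaban1985BackgroundPropagators, Thm 3.7 (3.90) p.409] -/
def Adm (E : RWModel Site β C A) (p : Site → β) (ω : Walk C) : Prop :=
  (∀ c ∈ ω.units, E.Mem p c) ∧ E.Geo ω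

/-- Admissibility of ω depends on the data restricted to N(ω) (law R1). [cite: Balaban1985BackgroundPropagators, Sect. C p.408] -/
theorem adm_congr {E : RWModel Site β C A} (L : E.Laws) {p p' : Site → β} {ω : Walk C}
    (hag : Set.EqOn p p' (ω.loc E.N)) : E.Adm p ω ↔ E.Adm p' ω := by
  unfold Adm
  refine and_congr_left fun _ => forall₂_congr fun c hc => ?_
  exact L.mem_local c (hag.mono (Walk.subset_loc E.N hc))

/-- Walks admissible for one problem and not for the other (the families 𝒟, 𝒟′ differ where the regions differ)
TOUCH Sᶜ (law R1) — so comparing the two expansions on one index set loses nothing. [cite: Balaban1985BackgroundPropagators, Sect. C p.408 + Thm 3.14 proof p.427] -/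
theorem touches_of_adm_of_not_adm {E : RWModel Site β C A} (L : E.Laws) {S : Set Site} {p p' : Site → β}
    (hag : Set.EqOn p p' S) {ω : Walk C} (h : E.Adm p ω) (h' : ¬ E.Adm p' ω) : ω.Touches E.N S := by
  rw [Walk.touches_iff_not_confined]
  exact fun hω => h' ((adm_congr L (hag.mono hω)).mp h)

section Ring

variable [Ring A]

open Classical in
/-- The INDICATOR-WEIGHTED TERM over ALL candidate walks: the term of (3.90) if ω is admissible for p, else 0 — so that
the expansions of two problems (two sequences {Ω_j}, {Ω′_j}, p. 426) are families on ONE index set. [cite: Balaban1985BackgroundPropagators, Thm 3.7 (3.90) p.409 + Thm 3.14 p.426] -/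
noncomputable def iterm (E : RWModel Site β C A) (p : Site → β) (ω : Walk C) : A :=
  if E.Adm p ω then ω.term E.F₀ E.F p else 0

/-- **Corollary 3.8, first clause, BOTH halves** (construction level): under the laws, the term of ω depends on the
data (U, {Ω_j}) restricted to N(ω) = □̃⁵₀ ∪ … ∪ □̃⁵ₙ. [cite: Balaban1985BackgroundPropagators, Cor 3.8 p.410 + Thm 3.10 p.416] -/
theorem iterm_congr {E : RWModel Site β C A} (L : E.Laws) {p p' : Site → β} {ω : Walk C}
    (hag : Set.EqOn p p' (ω.loc E.N)) : E.iterm p ω = E.iterm p' ω := by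
  by_cases h : E.Adm p ω
  · have h' : E.Adm p' ω := (adm_congr L hag).mp h
    unfold iterm
    rw [if_pos h, if_pos h', Walk.term_congr L.F₀_local L.F_local hag]
  · have h' : ¬ E.Adm p' ω := fun h' => h ((adm_congr L hag).mpr h')
    unfold iterm
    rw [if_neg h, if_neg h']

/-- Corollary 3.8, first clause, as a `DependsOnlyOn` statement (equivalently, by `dependsOnlyOn_iff_factorsThrough`:
the term is a function of the restricted data p|N(ω)). [cite: Balaban1985BackgroundPropagators, Cor 3.8 p.410] -/
theorem iterm_dependsOnlyOn {E : RWModel Site β C A} (L : E.Laws) (ω : Walk C) :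
    DependsOnlyOn (ω.loc E.N) (fun p => E.iterm p ω) :=
  fun _ _ hag => iterm_congr L hag

/-- **"COINCIDE"** ([Balaban1988Convergent] p. 278; p. 427 *"walks with localizations contained in Ω"*): two problems
whose data agree on a set S (same U; {Ω_j}, {Ω′_j} agreeing inside S — e.g. S = Λ_{k+1} versus the whole-lattice
problem of [I], or S = Ω = Ω_k ∩ Ω′_k) have IDENTICAL terms for every walk confined to S. [cite: Balaban1988Convergent, Sect. 3 p.278]
[cite: Balaban1985BackgroundPropagators, Thm 3.14 proof p.427] -/
theorem iterm_eq_of_confined {E : RWModel Site β C A} (L : E.Laws) {S : Set Site} {p p' : Site → β}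
    (hag : Set.EqOn p p' S) {ω : Walk C} (hω : ω.Confined E.N S) : E.iterm p ω = E.iterm p' ω :=
  iterm_congr L (hag.mono hω)

/-- **[Balaban1988Convergent] p. 278 literally** (*"the terms … for X ⊂ Λ_{k+1}, do not depend on Λ_{k+1}, and
coincide with the corresponding terms arising from the expressions defined on the whole lattice"*): a RESUMMATION of
walk terms over any finite set of walks confined to S is the same for two problems agreeing on S. [cite: Balaban1988Convergent, Sect. 3 p.278] -/
theorem sum_eq_sum_of_confined {E : RWModel Site β C A} (L : E.Laws) {S : Set Site} {p p' : Site → β}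
    (hag : Set.EqOn p p' S) (W : Finset (Walk C)) (hW : ∀ ω ∈ W, ω.Confined E.N S) :
    ∑ ω ∈ W, E.iterm p ω = ∑ ω ∈ W, E.iterm p' ω :=
  Finset.sum_congr rfl fun ω hω => iterm_eq_of_confined L hag (hW ω hω)

/-- The walks with a GIVEN localisation domain N(ω) = X — the resummation index of [Balaban1988Convergent] (3.47),
p. 278: *"[the expectation value in (3.37)] = Σ_{X∈𝐃_{k+1}, X⊃b} 𝐄₀^{(k+1)}(Λ_{k+1}, X, b)"*, obtained after *"the
operators in the first integral on the right-hand side of (3.37) are represented by the generalized random walk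
expansions. After the integration we get a representation of the form (3.47)"* (ibid.). [cite: Balaban1988Convergent, Sect. 3 (3.47) p.278] -/
def locClass (E : RWModel Site β C A) (X : Set Site) : Set (Walk C) := {ω | ω.loc E.N = X}

/-- The walk terms resummed over the walks with localisation domain exactly X: an 𝐄₀(·, X, ·)-type quantity at
construction level, for the random-walk part only (a series over the class; = 0 if not summable, by the `tsum`
convention). [cite: Balaban1988Convergent, Sect. 3 (3.47) p.278] -/
noncomputable def resum [TopologicalSpace A] (E : RWModel Site β C A) (p : Site → β) (X : Set Site) : A :=
  ∑' ω : E.locClass X, E.iterm p ω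

/-- **"do not depend on Λ_{k+1}"**: for X ⊆ S the resummed term 𝐄(X) is the same for two problems agreeing on S (no
convergence needed: `tsum` of pointwise-equal families). [cite: Balaban1988Convergent, Sect. 3 p.278] -/
theorem resum_eq_of_subset [TopologicalSpace A] {E : RWModel Site β C A} (L : E.Laws) {S X : Set Site}
    {p p' : Site → β} (hag : Set.EqOn p p' S) (hXS : X ⊆ S) : E.resum p X = E.resum p' X :=
  tsum_congr fun ω => iterm_eq_of_confined L hag (S := S) (by rw [Walk.Confined, show ω.1.loc E.N = X from ω.2]; exact hXS)

/-- Contrapositive bookkeeping: a walk that does not touch Sᶜ contributes zero to the difference. [cite: Balaban1985BackgroundPropagators, Thm 3.14 proof p.427] -/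
theorem iterm_sub_eq_zero_of_not_touches {E : RWModel Site β C A} (L : E.Laws) {S : Set Site}
    {p p' : Site → β} (hag : Set.EqOn p p' S) {ω : Walk C} (hω : ¬ ω.Touches E.N S) :
    E.iterm p ω - E.iterm p' ω = 0 := by
  rw [Walk.touches_iff_not_confined, not_not] at hω
  rw [iterm_eq_of_confined L hag hω, sub_self]

/-- **THE CANCELLATION SENTENCE, finite truncations** (p. 427: *"We take random walk expansions for both operators, and
in the difference all terms for walks with localizations contained in Ω are cancelled. Remaining terms correspond to
walks … for which at least one localization X_i intersects Ωᶜ"*): for ANY finite set W of candidate walks the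
difference of the two partial sums equals the partial sum, over the walks of W touching Sᶜ, of the term differences
(walks admissible for one problem only touch Sᶜ by law R1 and enter with one term zero). [cite: Balaban1985BackgroundPropagators, Thm 3.14 proof p.427] -/
theorem sum_sub_sum_eq_sum_touching {E : RWModel Site β C A} (L : E.Laws) {S : Set Site} {p p' : Site → β}
    (hag : Set.EqOn p p' S) (W : Finset (Walk C)) [DecidablePred (Walk.Touches E.N S)] :
    (∑ ω ∈ W, E.iterm p ω) - ∑ ω ∈ W, E.iterm p' ω =
      ∑ ω ∈ W.filter (Walk.Touches E.N S), (E.iterm p ω - E.iterm p' ω) := by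
  rw [← Finset.sum_sub_distrib]
  refine (Finset.sum_filter_of_ne fun ω _ hne => ?_).symm
  by_contra hω
  exact hne (iterm_sub_eq_zero_of_not_touches L hag hω)

end Ring

section Series

variable [NormedRing A]

/-- **THE CANCELLATION SENTENCE, convergent expansions**: if both expansions converge (Thm 3.7 / 3.9 / 3.10 for each
sequence — a hypothesis here), the difference of the two operators IS the sum over the walks touching Sᶜ of the term
differences. [cite: Balaban1985BackgroundPropagators, Thm 3.14 proof p.427] -/
theorem tsum_sub_tsum_eq_tsum_touching {E : RWModel Site β C A} (L : E.Laws) {S : Set Site} {p p' : Site → β}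
    (hag : Set.EqOn p p' S) (hs : Summable (E.iterm p)) (hs' : Summable (E.iterm p')) :
    (∑' ω, E.iterm p ω) - ∑' ω, E.iterm p' ω =
      ∑' ω : {ω : Walk C | ω.Touches E.N S}, (E.iterm p ω - E.iterm p' ω) := by
  rw [← hs.tsum_sub hs']
  refine (tsum_subtype_eq_of_support_subset ?_).symm
  intro ω hω
  by_contra hωS
  exact hω (iterm_sub_eq_zero_of_not_touches L hag hωS)

/-- The family of term differences restricted to the touching walks is summable when both expansions are. [folklore] -/
theorem summable_touching_sub [CompleteSpace A] {E : RWModel Site β C A} {S : Set Site} {p p' : Site → β}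
    (hs : Summable (E.iterm p)) (hs' : Summable (E.iterm p')) :
    Summable fun ω : {ω : Walk C | ω.Touches E.N S} => E.iterm p ω - E.iterm p' ω :=
  (hs.sub hs').subtype _

/-- **From term bounds to the bound of the difference** (the input of *"Then the exponential factor in (3.108) gives
the factor (3.154)"*, p. 427): if the terms of the two expansions are bounded in norm by summable families b, b′ (in the
paper: (3.94)/(3.99)/(3.108)), then the norm of the difference of the two operators is at most the sum of b + b′ over the
TOUCHING walks only — for which the metric step `B9Thm314.dOmega_le_wdist_add` converts e^{−½δ₀d(ω,y,y′)} into the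
factor (3.154). [cite: Balaban1985BackgroundPropagators, Thm 3.14 proof p.427 + (3.108) p.416] -/
theorem norm_tsum_sub_tsum_le [CompleteSpace A] {E : RWModel Site β C A} (L : E.Laws) {S : Set Site}
    {p p' : Site → β} (hag : Set.EqOn p p' S) {b b' : Walk C → ℝ} (hb : ∀ ω, ‖E.iterm p ω‖ ≤ b ω)
    (hb' : ∀ ω, ‖E.iterm p' ω‖ ≤ b' ω) (hs : Summable b) (hs' : Summable b') :
    ‖(∑' ω, E.iterm p ω) - ∑' ω, E.iterm p' ω‖ ≤
      ∑' ω : {ω : Walk C | ω.Touches E.N S}, (b ω + b' ω) := by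
  rw [tsum_sub_tsum_eq_tsum_touching L hag (hs.of_norm_bounded hb) (hs'.of_norm_bounded hb')]
  refine tsum_of_norm_bounded ((hs.add hs').subtype _).hasSum fun ω => ?_
  exact (norm_sub_le _ _).trans (add_le_add (hb ω) (hb' ω))

end Series

end RWModel

/-! ## §3 The setting of Theorem 3.14: one gauge field, two sequences of domains -/

section TwoSequences

variable {Site β₁ β₂ : Type*}

/-- p. 426: *"We construct operators for both sequences"* {Ω_j}, {Ω′_j} for the SAME U: the data functions
x ↦ (U-data at x, scale label of x) agree on a set S iff the scale labels do. [cite: Balaban1985BackgroundPropagators, Thm 3.14 p.426] -/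
theorem eqOn_pair_iff (u : Site → β₁) (r r' : Site → β₂) (S : Set Site) :
    Set.EqOn (fun x => (u x, r x)) (fun x => (u x, r' x)) S ↔ Set.EqOn r r' S := by
  simp only [Set.EqOn, Prod.mk.injEq, true_and]

/-- Hence (with `RWModel.iterm_eq_of_confined`): for the same U and two sequences whose scale labels agree on S, every
walk confined to S has the same term in both expansions — [Balaban1988Convergent] p. 278 with S = Λ_{k+1} (inside
which both the {Ω_j}-problem and the whole-lattice problem of [I] carry the top label), p. 427 with S = Ω = Ω_k ∩ Ω′_k.
[cite: Balaban1988Convergent, Sect. 3 p.278] [cite: Balaban1985BackgroundPropagators, Thm 3.14 proof p.427] -/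
theorem iterm_eq_of_labels_agree {C A : Type*} [Ring A] {E : RWModel Site (β₁ × β₂) C A} (L : E.Laws)
    (u : Site → β₁) {r r' : Site → β₂} {S : Set Site} (hrr' : Set.EqOn r r' S) {ω : Walk C}
    (hω : ω.Confined E.N S) :
    E.iterm (fun x => (u x, r x)) ω = E.iterm (fun x => (u x, r' x)) ω :=
  RWModel.iterm_eq_of_confined L ((eqOn_pair_iff u r r' S).mpr hrr') hω

end TwoSequences

end Literature.MathematicalPhysics.QuantumFieldTheory.Balaban1983to89.B9Locality
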